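import Summits.BirchSwinnertonDyer.BirchSwinnertonDyer.Theorems.PrintCf2RubinValueTwoEllipticUnitsTwoVariableMeasureSteps
import Summits.BirchSwinnertonDyer.BirchSwinnertonDyer.Theorems.PrintCf2RubinValueTwoEllipticUnitsTwoVariableMeasureDischarged
import Summits.BirchSwinnertonDyer.BirchSwinnertonDyer.Theorems.PrintCf2RubinValueTwoEllipticUnitsTwoVariableDivisionTwistsGeneral
import HarnessLib

/-!
# de Shalit II.4.14 Step 1 / II.4.16 ON `Γ_K`, every non-print hypothesis discharged, along ANY chain of moduli with one-prime steps
# `𝔣_{k+1} = 𝔣_k·𝔩_k`, `𝔣_k = 𝔪_k·v̄^{b_k+1}` (the chains through all the primes of `S ∪ {𝔭̄}`; `𝔪_k` arbitrary, `S = ∅` allowed)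

Cell `bsd-print-cf2`, width seat `bsd-line-cf2-p1-w8` g11; `--supports` the banked S3a item stmt-BirchSwinnertonDyer-24721 (helper, Theses-free).
THEOREMS ONLY; CONDITIONAL on the published named facts de Shalit II.2.4 (i)/(ii)/(iii), II.2.5 (i) (hypotheses, never asserted).

The sibling `…TwoVariableMeasureDischarged.exists_twoVariableMeasure_of_principal_split` (p760903) discharged the two-variable measure for the
moduli `𝔤v̄^{m+1}` with `𝔤` FIXED, conjugation-stable and `w_𝔤 = 1` — a diagonal tower reaching `Gal(K̄/K(𝔤p^∞))` only.  The R3 endpoint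
needs `⋂_n U_n ⊆ rayKer K 2 S = Gal(K̄/K(∏_{w∈S} w^∞ · p^∞))`, i.e. (II.4.16, `RayClassTowerDiagonalSplit.lean`) a chain of moduli through EVERY
prime of `S ∪ {𝔭̄}` infinitely often.  THIS file discharges the measure along an ARBITRARY such chain: moduli `𝔣_k = 𝔪_k · v̄^{b_k+1}`
(`v ∤ 𝔪_k`, `v̄ ∤ 𝔪_k`, `b_k ≥ 1`, no stability or unit condition on `𝔪_k`) with one-prime steps `𝔣_{k+1} = 𝔣_k·𝔩_k`, `𝔩_k ∣ 𝔣_k`, for `K`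
imaginary quadratic, `2 = v·v̄` split, `v = (α₀)` principal and `w_{v̄²} = 1` (`−2 ∉ v̄²`); the twists are ALL ideals prime to `𝔣_0 v` (every
`𝔣_k` has the same support); the division twists at each modulus come from `exists_divisionTwists_twoVariable_general`:

* `isCoprime_chain` (`(𝔠, 𝔣_0 v) = 1 ⟹ (𝔠, 𝔣_k v) = 1`), `not_chain_le` (`v ∤ 𝔣_k`), `units_eq_one_chain` (`w_{𝔣_k} = 1`);
* ★ (D1) `exists_localDatum_of_principal_split` — the LOCAL ANALYTIC DATUM `(hq, h2, u = α₀/2, σ₀, ε, θ, e₂, θ|_{𝒪_v} = e₂)` at `v`, which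
  depends on `(K, v, v̄, α₀)` ONLY (not on `S`, not on the chain): the quantifier order of the R3 endpoint (`∃ Ω Ωp, ∀ S, ∃ 𝒰 μ`) requires the
  `p`-adic period — a function of `(σ₀, ε, θ, u)` — to be chosen BEFORE `S`;
* ★★★ (D2) `exists_twoVariableMeasure_of_principal_split_steps_of_localDatum` — FOR ANY such datum and ANY chain: ∃ all the per-modulus data
  and a bounded `μ` on `Γ_K` along the diagonal tower `V_n = Gal(K̄/K(𝔣_n v^{n+1}))`, `‖μ‖ = 1`, with `δ_{g_𝔠, N𝔠} μ = i_n(e_{𝔣_n}(𝔠))` at every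
  level `n`, for every `𝔠` prime to `𝔣_0 v`, the local measures read through the GIVEN datum.  (The one-shot form is
  `obtain ⟨hq, h2, u, hu, σ₀, hσ₀, ε, hε, θ, hθc, hθ1, hθζ, e₂, hΘe, -⟩ := exists_localDatum_of_principal_split …` followed by
  `exists_twoVariableMeasure_of_principal_split_steps_of_localDatum … hq h2 u hu hσ₀ hε θ hθ1 e₂ hΘe`.)

HONEST FRAMING: an assembly of accepted kernel theorems over published named facts; nothing here closes a crux; no summit statement is proved;
BSD is not proved by any of this.

## References
* [deShalit1987] E. de Shalit, *Iwasawa theory of elliptic curves with complex multiplication* (1987), II.4.14 Step 1 (p. 71), II.4.16 (p. 76),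
  II.4.12 (p. 66–69), II.4.17 (p. 77–78).
* [NeukirchANT1999] J. Neukirch, *Algebraic Number Theory* (1999), Ch. VI §7 Thm. (7.1).
-/

-- the summit namespace `Summit.BirchSwinnertonDyer.BirchSwinnertonDyer` repeats the problem name by design (D-0017)
set_option linter.dupNamespace false
set_option autoImplicit false

noncomputable section

open scoped Classical nonZeroDivisors NumberField
open Field IsDedekindDomain IsDedekindDomain.HeightOneSpectrum ValuativeRel IsLocalRing MvPowerSeries
open Literature.NumberTheory.NumberFields
open Literature.NumberTheory.GaloisRepresentations Literature.NumberTheory.GaloisRepresentations.IsNonarchimedeanLocalField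
  Literature.NumberTheory.GaloisRepresentations.LubinTate Literature.NumberTheory.GaloisRepresentations.ArtinLocalGlobal
  Literature.NumberTheory.PAdicHodge
open Literature.NumberTheory.EllipticCurves Literature.NumberTheory.EllipticCurves.GroupDistribution
open Literature.NumberTheory.ComplexMultiplication.EllipticUnits
open Literature.NumberTheory.LFunctions.AbelianDensity (artinSymbol)
open Summit.BirchSwinnertonDyer.BirchSwinnertonDyer.Theorems.PrintCf2.EllipticUnitsLocal
open Summit.BirchSwinnertonDyer.BirchSwinnertonDyer.Theorems.PrintCf2.EllipticUnitsGlobal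

namespace Summit.BirchSwinnertonDyer.BirchSwinnertonDyer.Theorems.PrintCf2.EllipticUnitsTwoVariable

variable {K : Type} [Field K] [NumberField K] {v vbar : HeightOneSpectrum (𝓞 K)}

/-! ## §1. Bookkeeping along a chain `𝔣_{k+1} = 𝔣_k·𝔩_k`, `𝔩_k ∣ 𝔣_k`, `𝔣_k = 𝔪_k·v̄^{b_k+1}` -/

section Chain

variable (𝔣 : ℕ → Ideal (𝓞 K)) (𝔩 : ℕ → HeightOneSpectrum (𝓞 K)) (h𝔣succ : ∀ k, 𝔣 (k + 1) = 𝔣 k * (𝔩 k).asIdeal)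
  (hdiv : ∀ k, (𝔩 k).asIdeal ∣ 𝔣 k)

omit [NumberField K] in
include h𝔣succ in
/-- The chain is antitone. [cite: deShalit1987, II.4.14 Step 1 (p. 71)] -/
theorem chain_anti (k : ℕ) : 𝔣 (k + 1) ≤ 𝔣 k := by rw [h𝔣succ]; exact Ideal.mul_le_right

omit [NumberField K] in
include h𝔣succ hdiv in
/-- **A twist prime to `𝔣_0 v` is prime to every `𝔣_k v`** (each step multiplies by a prime already dividing the modulus). [folklore] -/
theorem isCoprime_chain {𝔠 : Ideal (𝓞 K)} (h : IsCoprime 𝔠 (𝔣 0 * v.asIdeal)) : ∀ k, IsCoprime 𝔠 (𝔣 k * v.asIdeal) := by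
  intro k
  induction k with
  | zero => exact h
  | succ k ih =>
    rw [h𝔣succ, mul_right_comm]
    exact ih.mul_right (ih.of_isCoprime_of_dvd_right ((hdiv k).trans (dvd_mul_right _ _)))

/-- `v ∤ 𝔪·v̄^{b+1}` for `v ∤ 𝔪`, `v ≠ v̄`. [cite: deShalit1987, II.4.14 (p. 70)] -/
theorem not_chain_le {𝔪c : Ideal (𝓞 K)} (hv : ¬ 𝔪c ≤ v.asIdeal) (hne : vbar ≠ v) (b : ℕ) :
    ¬ 𝔪c * vbar.asIdeal ^ (b + 1) ≤ v.asIdeal := by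
  intro h
  rcases (v.isPrime.mul_le.mp h) with h1 | h1
  · exact hv h1
  · exact hne (HeightOneSpectrum.ext (vbar.isMaximal.eq_of_le v.isPrime.ne_top (v.isPrime.le_of_pow_le h1)).symm).symm

omit [NumberField K] in
/-- `w_{𝔪v̄^{b+1}} = 1` from `w_{v̄²} = 1` and `b ≥ 1`. [cite: deShalit1987, II.1.7 (p. 41)] -/
theorem units_eq_one_chain (hw2 : ∀ u : (𝓞 K)ˣ, (u : 𝓞 K) - 1 ∈ vbar.asIdeal ^ 2 → u = 1) {𝔪c : Ideal (𝓞 K)} {b : ℕ} (hb : 1 ≤ b)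
    (u : (𝓞 K)ˣ) (hu : (u : 𝓞 K) - 1 ∈ 𝔪c * vbar.asIdeal ^ (b + 1)) : u = 1 :=
  hw2 u (Ideal.pow_le_pow_right (by omega) (Ideal.mul_le_left hu))

omit [NumberField K] in
/-- `w_{𝔪v̄²} = 1` from `w_{v̄²} = 1`. [cite: deShalit1987, II.1.7 (p. 41)] -/
theorem units_eq_one_mul_sq (hw2 : ∀ u : (𝓞 K)ˣ, (u : 𝓞 K) - 1 ∈ vbar.asIdeal ^ 2 → u = 1) {𝔪c : Ideal (𝓞 K)}
    (u : (𝓞 K)ˣ) (hu : (u : 𝓞 K) - 1 ∈ 𝔪c * vbar.asIdeal ^ 2) : u = 1 :=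
  hw2 u (Ideal.mul_le_left hu)

end Chain

/-! ## §2. (D1) The local analytic datum at `v` — depends on `(K, v, v̄, α₀)` only, NOT on `S` or on the chain -/

section LocalDatum

attribute [local instance] ltNormUniformSpace ltNormIsUniformAddGroup rk1 nF nE fintypeResidueField

set_option maxHeartbeats 1600000 in
/-- ★ **(D1) The local analytic datum, chosen ONCE per `(K, v, α₀)`.**  For `K` imaginary quadratic, `2 = v·v̄` split (`v̄ ≠ v`) and `v = (α₀)`:
there exist `hq : #k_v = 2`, `h2 : 2` a uniformizer of `K_v`, ONE unit `u = α₀/2 ∈ 𝒪_v^×`, an arithmetic Frobenius `σ₀`, a unit `ε` of `𝒪̂_v^{nr}`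
with `σ₀ε = uε` (II.4.7), a continuous `θ : ℂ_v → ℂ₂` of norm `≤ 1` on the unit ball hitting all `2`-power roots of unity, and `e₂ : 𝒪_v ≃ ℤ₂`
with `θ|_{𝒪_v} = e₂` (read in `ℂ₂`); moreover `θ` is bijective and maps the open unit ball into the open unit ball.  (Every later choice — the
two-variable measure for a set `S`, its chain of moduli — is made AFTER this datum, so a `p`-adic period built from `(σ₀, ε, θ, u)` is common
to all `S`.) [cite: deShalit1987, II.4.7 (17) (p. 60), II.4.11 (p. 65), II.4.14 Step 1 (p. 71)] -/
theorem exists_localDatum_of_principal_split (hK : IsImaginaryQuadratic K)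
    (hv2 : ((2 : ℕ) : 𝓞 K) ∈ v.asIdeal) (hvbar2 : ((2 : ℕ) : 𝓞 K) ∈ vbar.asIdeal) (hne : vbar ≠ v)
    {α₀ : 𝓞 K} (hv0 : v.asIdeal = Ideal.span {α₀}) :
    ∃ (_ : residueFieldCard (v.adicCompletion K) = 2)
      (_ : (valuation (v.adicCompletion K)).IsUniformizer ((((2 : ℕ) : 𝒪[v.adicCompletion K]) : v.adicCompletion K)))
      (u : 𝒪[v.adicCompletion K]ˣ)
      (_ : ((((u : 𝒪[v.adicCompletion K]) * ((2 : ℕ) : 𝒪[v.adicCompletion K]) : 𝒪[v.adicCompletion K]) : v.adicCompletion K)) = ((α₀ : K) : v.adicCompletion K))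
      (σ₀ : absoluteGaloisGroup (v.adicCompletion K)) (_ : IsAbsArithFrob σ₀)
      (ε : (maxUnramifiedCompletion (v.adicCompletion K))ˣ)
      (_ : maxUnramifiedCompletion.galAut (v.adicCompletion K) σ₀ (ε : maxUnramifiedCompletion (v.adicCompletion K)) =
        algebraMap 𝒪[v.adicCompletion K] (maxUnramifiedCompletion (v.adicCompletion K)) (u : 𝒪[v.adicCompletion K]) * (ε : maxUnramifiedCompletion (v.adicCompletion K)))
      (θ : CompletedAlgClosure (v.adicCompletion K) →+* ℂ_[2]) (_ : Continuous θ)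
      (_ : ∀ z : CBall (v.adicCompletion K), ‖θ (z : CompletedAlgClosure (v.adicCompletion K))‖ ≤ 1)
      (_ : ∀ ζ' : ℂ_[2], (∃ n : ℕ, ζ' ^ 2 ^ n = 1) → ∃ ζ : CompletedAlgClosure (v.adicCompletion K), (∃ n : ℕ, ζ ^ 2 ^ n = 1) ∧ θ ζ = ζ')
      (e₂ : v.adicCompletionIntegers K ≃+* ℤ_[2]),
      (∀ a : 𝒪[v.adicCompletion K], (θ.comp ((CBall (v.adicCompletion K)).subtype.comp (algebraMap (UnrCoeff (v.adicCompletion K)) (CBall (v.adicCompletion K)))))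
          (intToUnrCoeff (v.adicCompletion K) a) =
        padicIntCast ℂ_[2] (((e₂ : v.adicCompletionIntegers K →+* ℤ_[2]).comp (integerEquivAdicCompletionIntegers v).toRingHom) a)) ∧
      Function.Bijective θ ∧ (∀ z : CompletedAlgClosure (v.adicCompletion K), ‖z‖ < 1 → ‖θ z‖ < 1) := by
  haveI := liesOver_ratPlace_of_natCast_mem K v (p := 2) hv2
  obtain ⟨he, hf⟩ := ramificationIdx_eq_one_and_inertiaDeg_eq_one_of_natCast_mem_of_ne K hK.1 (p := 2) hv2 hvbar2 hne
  obtain ⟨θ, hθc, hθb, hθ1, hθζ, hΘe, -, hθlt⟩ := Seam.exists_theta_two_moments_padicEquivOfDegreeOne K v he hf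
  set e₂ : v.adicCompletionIntegers K ≃+* ℤ_[2] := padicIntEquivOfDegreeOne K 2 v he hf with he₂
  obtain ⟨u, hu⟩ := exists_unit_mul_two_eq e₂ hv0
  obtain ⟨σ₀, hσ₀⟩ := exists_isAbsArithFrob_holds (v.adicCompletion K)
  obtain ⟨ε, hε⟩ := exists_unit_galAut_eq_mul hσ₀ u
  refine ⟨residueFieldCard_adicCompletion_of_padicIntEquiv (v := v) e₂, isUniformizer_natCast_adicCompletion_of_padicIntEquiv (v := v) e₂,
    u, hu, σ₀, hσ₀, ε, hε, θ, hθc, hθ1, hθζ, e₂, ?_, hθb, hθlt⟩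
  exact hΘe

end LocalDatum

/-! ## §3. (D2) The discharge along the chain, GIVEN a local datum -/

section Discharged

attribute [local instance] GlobalNormCoherentUnits.instCommMonoid GlobalNormCoherentUnits.galAction
attribute [local instance] ltNormUniformSpace ltNormIsUniformAddGroup rk1 nF nE fintypeResidueField
attribute [local instance] RelNormCoherentUnits.instCommMonoid

set_option maxHeartbeats 3200000 in
/-- ★★★ **(D2) de Shalit II.4.14 Step 1 / II.4.16 ON `Γ_K` ALONG ANY ONE-PRIME-STEP CHAIN, FOR A GIVEN LOCAL DATUM, every other non-print
hypothesis discharged.**  For `K` imaginary quadratic (`ι : K → ℂ`), `2 = v·v̄` SPLIT (`v̄ ≠ v`) with `v = (α₀)` principal and `w_{v̄²} = 1`, a chain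
`𝔣_{k+1} = 𝔣_k·𝔩_k` (`𝔩_k ∣ 𝔣_k`) of moduli `𝔣_k = 𝔪_k·v̄^{b_k+1}` with `v ∤ 𝔪_k`, `v̄ ∤ 𝔪_k`, `b_k ≥ 1` (no stability, no unit condition on
the `𝔪_k`; e.g. the chains through the primes of `S ∪ {v̄}` of II.4.16, or `𝔣_k = v̄^{k+2}` for `S = ∅`), GIVEN the four prints II.2.4
(i)/(ii)/(iii), II.2.5 (i), and GIVEN a local datum `(hq, h2, u = α₀/2, σ₀, ε, θ, e₂, θ|_{𝒪_v} = e₂)` at `v` (§2, chosen before `S`): **there exist** the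
per-modulus data (exponents `f_k` with global witnesses `α_k = α₀^{f_k} ≡ 1 mod 𝔣_k`, increasing unramified Galois coefficient fields `E_k`,
compatible readings `j_k`, cell maps `ψ_k`, lifts `g_𝔠 ∈ Γ_K` of the Artin symbols on all `K(𝔣_k v^{n+1})` and elliptic units for every ideal
`𝔠 ≠ 0` prime to `𝔣_0 v`) **and a bounded distribution `μ` on `Γ_K` along the diagonal tower `V_n = Gal(K̄/K(𝔣_n v^{n+1}))`, `‖μ‖ = 1`, with
`δ_{g_𝔠, N𝔠} μ = i_n(e_{𝔣_n}(𝔠))` at level `n` for every `𝔠` and every `n`** — the local measures read through THE GIVEN `(u, σ₀, ε, θ, e₂)`.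
[cite: deShalit1987, II.4.14 Step 1 (p. 71), II.4.16 (p. 76), II.4.12 (p. 66–69), II.4.17 (p. 77–78)] [cite: NeukirchANT1999, Ch. VI §7 Thm. (7.1)] -/
theorem exists_twoVariableMeasure_of_principal_split_steps_of_localDatum [NumberField.IsTotallyComplex K]
    (h24i : DeShalit1987.prop24_i_mem_rayClassField) (h24ii : DeShalit1987.prop24_ii_galoisAction)
    (h24iii : DeShalit1987.prop24_iii_unit) (h25 : DeShalit1987.prop25_i_normRelation)
    (hK : IsImaginaryQuadratic K) (ι : K →+* ℂ)
    (𝔣 : ℕ → Ideal (𝓞 K)) (𝔩 : ℕ → HeightOneSpectrum (𝓞 K)) (h𝔣succ : ∀ k, 𝔣 (k + 1) = 𝔣 k * (𝔩 k).asIdeal)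
    (hdiv : ∀ k, (𝔩 k).asIdeal ∣ 𝔣 k)
    (𝔪c : ℕ → Ideal (𝓞 K)) (b : ℕ → ℕ) (h𝔣eq : ∀ k, 𝔣 k = 𝔪c k * vbar.asIdeal ^ (b k + 1)) (hb : ∀ k, 1 ≤ b k)
    (h𝔪v : ∀ k, ¬ 𝔪c k ≤ v.asIdeal) (h𝔪vbar : ∀ k, ¬ 𝔪c k ≤ vbar.asIdeal)
    (hw2 : ∀ u : (𝓞 K)ˣ, (u : 𝓞 K) - 1 ∈ vbar.asIdeal ^ 2 → u = 1)
    (hv2 : ((2 : ℕ) : 𝓞 K) ∈ v.asIdeal) (hvbar2 : ((2 : ℕ) : 𝓞 K) ∈ vbar.asIdeal) (hne : vbar ≠ v)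
    {α₀ : 𝓞 K} (hv0 : v.asIdeal = Ideal.span {α₀})
    (hq : residueFieldCard (v.adicCompletion K) = 2)
    (h2 : (valuation (v.adicCompletion K)).IsUniformizer ((((2 : ℕ) : 𝒪[v.adicCompletion K]) : v.adicCompletion K)))
    (u : 𝒪[v.adicCompletion K]ˣ)
    (hu : ((((u : 𝒪[v.adicCompletion K]) * ((2 : ℕ) : 𝒪[v.adicCompletion K]) : 𝒪[v.adicCompletion K]) : v.adicCompletion K)) = ((α₀ : K) : v.adicCompletion K))
    {σ₀ : absoluteGaloisGroup (v.adicCompletion K)} (hσ₀ : IsAbsArithFrob σ₀)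
    {ε : (maxUnramifiedCompletion (v.adicCompletion K))ˣ}
    (hε : maxUnramifiedCompletion.galAut (v.adicCompletion K) σ₀ (ε : maxUnramifiedCompletion (v.adicCompletion K)) =
      algebraMap 𝒪[v.adicCompletion K] (maxUnramifiedCompletion (v.adicCompletion K)) (u : 𝒪[v.adicCompletion K]) * (ε : maxUnramifiedCompletion (v.adicCompletion K)))
    (θ : CompletedAlgClosure (v.adicCompletion K) →+* ℂ_[2])
    (hθ1 : ∀ z : CBall (v.adicCompletion K), ‖θ (z : CompletedAlgClosure (v.adicCompletion K))‖ ≤ 1)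
    (e₂ : v.adicCompletionIntegers K ≃+* ℤ_[2])
    (hΘe : ∀ a : 𝒪[v.adicCompletion K], (θ.comp ((CBall (v.adicCompletion K)).subtype.comp
        (algebraMap (UnrCoeff (v.adicCompletion K)) (CBall (v.adicCompletion K))))) (intToUnrCoeff (v.adicCompletion K) a) =
      padicIntCast ℂ_[2] (((e₂ : v.adicCompletionIntegers K →+* ℤ_[2]).comp (integerEquivAdicCompletionIntegers v).toRingHom) a)) :
    ∃ (h𝔣0 : ∀ m : ℕ, 𝔣 m ≠ ⊥) (h𝔣1 : ∀ m : ℕ, 𝔣 m ≠ ⊤)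
      (hvm : ∀ m : ℕ, ¬ 𝔣 m ≤ v.asIdeal)
      (hwm : ∀ (m : ℕ) (u : (𝓞 K)ˣ), (u : 𝓞 K) - 1 ∈ 𝔣 m → u = 1)
      (hle : ∀ m : ℕ, 𝔣 (m + 1) ≤ 𝔣 m)
      (α : ℕ → 𝓞 K) (hα0 : ∀ m, α m ≠ 0) (hα𝔣 : ∀ m, α m - 1 ∈ 𝔣 m)
      (hαw : ∀ (m : ℕ) (w : HeightOneSpectrum (𝓞 K)), w ≠ v → α m ∉ w.asIdeal)
      (f : ℕ → ℕ) (hαπ : ∀ m, ((α m : K) : v.adicCompletion K) =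
        ((((u : 𝒪[v.adicCompletion K]) * ((2 : ℕ) : 𝒪[v.adicCompletion K]) : 𝒪[v.adicCompletion K]) : v.adicCompletion K)) ^ f m)
      (E : ℕ → IntermediateField (v.adicCompletion K) (AlgebraicClosure (v.adicCompletion K)))
      (_ : ∀ m, FiniteDimensional (v.adicCompletion K) (E m)) (_ : ∀ m, IsGalois (v.adicCompletion K) (E m))
      (hE : ∀ m, E m ≤ maxUnramified (v.adicCompletion K))
      (hdegE : ∀ (m : ℕ) (w : WeilGroup (v.adicCompletion K)),
        WeilGroup.toAbsGalois (v.adicCompletion K) w ∈ (E m).fixingSubgroup → (f m : ℤ) ∣ WeilGroup.deg w)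
      (hEE : ∀ m, E m ≤ E (m + 1))
      (j : ∀ m : ℕ, unitBall (E m) →+* UnrCoeff (v.adicCompletion K))
      (_ : ∀ m, (j m).comp (algebraMap (LTCoeff (v.adicCompletion K)) (unitBall (E m))) =
        (intToUnrCoeff (v.adicCompletion K)).comp (LTCoeff.of (v.adicCompletion K)).symm.toRingHom)
      (hjC : ∀ m, (algebraMap (UnrCoeff (v.adicCompletion K)) (CBall (v.adicCompletion K))).comp (j m) = unitBallToCBall (E m))
      (_ : ∀ (m : ℕ) (y : unitBall (E m)), j (m + 1) (inclUnitBall (F := v.adicCompletion K) (hEE m) y) = j m y)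
      (ψ : ∀ m n : ℕ, ↥(absRestrictNormalHom (rayClassField K (𝔣 m))).ker ⧸
        (rayAdicTower (𝔪 := 𝔣 m) (h𝔣0 m) v).U n → ZMod (2 ^ (n + 1)))
      (hψ : ∀ (m n : ℕ) (g : ↥(absRestrictNormalHom (rayClassField K (𝔣 m))).ker),
        g ∈ (rayAdicTower (𝔪 := 𝔣 m) (h𝔣0 m) v).U 0 →
        ψ m n ((rayAdicTower (𝔪 := 𝔣 m) (h𝔣0 m) v).proj n g) =
          PadicInt.toZModPow (n + 1) ((((Units.map (e₂ : v.adicCompletionIntegers K →+* ℤ_[2]).toMonoidHom).comp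
            (rayAdicCharacter (h𝔣0 m) (hvm m) (hwm m)))⁻¹ g : ℤ_[2]ˣ) : ℤ_[2]))
      (g : {c : Ideal (𝓞 K) // c ≠ ⊥ ∧ IsCoprime c (𝔣 0 * v.asIdeal)} → absoluteGaloisGroup K)
      (_ : ∀ (c : {c : Ideal (𝓞 K) // c ≠ ⊥ ∧ IsCoprime c (𝔣 0 * v.asIdeal)}) (m k : ℕ),
        absRestrictNormalHom (rayClassField K (𝔣 m * v.asIdeal ^ (k + 1))) (g c) =
          artinSymbol (galFrob K (rayClassField K (𝔣 m * v.asIdeal ^ (k + 1)))) c.1)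
      (x : ∀ (_ : {c : Ideal (𝓞 K) // c ≠ ⊥ ∧ IsCoprime c (𝔣 0 * v.asIdeal)}) (m k : ℕ),
        rayClassField K (𝔣 m * v.asIdeal ^ (k + 1)))
      (hx : ∀ (c : {c : Ideal (𝓞 K) // c ≠ ⊥ ∧ IsCoprime c (𝔣 0 * v.asIdeal)}) (m k : ℕ),
        IsThetaValueOne ι (𝔣 m * v.asIdeal ^ (k + 1)) c.1
          (algClosureEmb ι ((x c m k : rayClassField K (𝔣 m * v.asIdeal ^ (k + 1))) : AlgebraicClosure K)))
      (_ : ∀ m n, ((rayAdicTower (𝔪 := 𝔣 m) (h𝔣0 m) v).U n).Normal)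
      (_ : ∀ m n, ((absRayAdicTower (𝔪' := 𝔣 m) (h𝔣0 m) v).U n).Normal),
    ∃ μ : GroupDistribution (SubgroupTower.diagonal (fun m ↦ absRayAdicTower (𝔪' := 𝔣 m) (h𝔣0 m) v)
        (fun m n ↦ absRayAdicTower_U_anti (h𝔣0 m) (h𝔣0 (m + 1)) v (hle m) n)) ℂ_[2], μ.bound = 1 ∧
      ∀ (c : {c : Ideal (𝓞 K) // c ≠ ⊥ ∧ IsCoprime c (𝔣 0 * v.asIdeal)}) (n : ℕ)
        (b : absoluteGaloisGroup K ⧸ (absRayAdicTower (𝔪' := 𝔣 n) (h𝔣0 n) v).U n),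
        (twisting (g c) (Ideal.absNorm c.1 : ℂ_[2]) μ).μ n b =
        (GroupDistribution.induceFrom (Γ := absoluteGaloisGroup K)
          (fun k ↦ rayAdicTower_U_eq_subgroupOf (𝔪 := 𝔣 n) (h𝔣0 n) v k)
          (fun b : GlobalNormCoherentUnits (h𝔣0 n) v ↦
            localMeasureFamily (h𝔣0 n) (hvm n) (hwm n) hq h2 u (E n) (hE n) hσ₀ hε θ hθ1 (j n) (hjC n) e₂ (ψ n) (hψ n)
              (RelNormCoherentUnits.ofGlobalUnits (h𝔣0 n) (hvm n) (hwm n) (isUniformizer_unit_mul h2 u) (hα0 n) (hα𝔣 n) (hαw n)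
                (hαπ n) (E n) (hE n) (hdegE n) b))
          zero_le_one (fun _ ↦ le_rfl)
          (ellipticUnitsGlobal h24iii h25 hK ι (h𝔣0 n) (h𝔣1 n) (hvm n) (hwm n) c.2.1 (isCoprime_chain 𝔣 𝔩 h𝔣succ hdiv c.2.2 n)
            (x c n) (hx c n))).μ n b := by
  -- (0) the frame: `[K : ℚ] = 2`; the moduli
  have hK2 : Module.finrank ℚ K = 2 := hK.1
  have h𝔪0 : ∀ k, 𝔪c k ≠ ⊥ := fun k h ↦ h𝔪v k (h ▸ bot_le)
  have h𝔣0 : ∀ m : ℕ, 𝔣 m ≠ ⊥ := fun m ↦ by rw [h𝔣eq]; exact mul_pow_succ_ne_bot (h𝔪0 m) vbar (b m)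
  have h𝔣1 : ∀ m : ℕ, 𝔣 m ≠ ⊤ := fun m ↦ by rw [h𝔣eq]; exact mul_pow_succ_ne_top (𝔪c m) vbar (b m)
  have hvm : ∀ m : ℕ, ¬ 𝔣 m ≤ v.asIdeal := fun m ↦ by rw [h𝔣eq]; exact not_chain_le (h𝔪v m) hne (b m)
  have hwm : ∀ (m : ℕ) (u : (𝓞 K)ˣ), (u : 𝓞 K) - 1 ∈ 𝔣 m → u = 1 := fun m u hu ↦
    units_eq_one_chain hw2 (hb m) u ((h𝔣eq m) ▸ hu)
  have hle : ∀ m : ℕ, 𝔣 (m + 1) ≤ 𝔣 m := chain_anti 𝔣 𝔩 h𝔣succ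
  -- (2) the exponents `f_m` with `α₀^{f_m} ≡ 1 mod 𝔣_m` (`α₀ = u·2` by the datum)
  have hF : ∀ m : ℕ, ∃ fm : ℕ, 0 < fm ∧ α₀ ^ fm - 1 ∈ 𝔣 m :=
    fun m ↦ exists_pow_sub_one_mem_of_asIdeal_eq_span (h𝔣0 m) (hvm m) hv0
  choose f hf0 hf𝔪 using hF
  have hαπ : ∀ m, (((α₀ ^ f m : 𝓞 K) : K) : v.adicCompletion K) =
      ((((u : 𝒪[v.adicCompletion K]) * ((2 : ℕ) : 𝒪[v.adicCompletion K]) : 𝒪[v.adicCompletion K]) : v.adicCompletion K)) ^ f m := by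
    intro m
    have h1 : ((α₀ ^ f m : 𝓞 K) : K) = ((α₀ : 𝓞 K) : K) ^ f m := by
      rw [NumberField.RingOfIntegers.coe_eq_algebraMap, map_pow, ← NumberField.RingOfIntegers.coe_eq_algebraMap]
    rw [h1, coe_pow_adicCompletion, hu]
  -- (3) the unramified stages `E_m := unrStage K_v (Σ_{i≤m} f_i)` (increasing); the readings `j_m`
  set Fsum : ℕ → ℕ := fun m ↦ (Finset.range (m + 1)).sum f with hFsum
  have hFmono : ∀ m, Fsum m ≤ Fsum (m + 1) := fun m ↦ by
    simp only [hFsum, Finset.sum_range_succ _ (m + 1)]; exact Nat.le_add_right _ _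
  have hfF : ∀ m, f m ≤ Fsum m + 1 := fun m ↦ by
    have : f m ≤ Fsum m := Finset.single_le_sum (f := f) (fun i _ ↦ Nat.zero_le _) (Finset.self_mem_range_succ m)
    omega
  set E : ℕ → IntermediateField (v.adicCompletion K) (AlgebraicClosure (v.adicCompletion K)) :=
    fun m ↦ unrStage (v.adicCompletion K) (Fsum m) with hEdef
  haveI hfd : ∀ m, FiniteDimensional (v.adicCompletion K) (E m) := fun m ↦ finiteDimensional_unrStage _ _
  haveI hgal : ∀ m, IsGalois (v.adicCompletion K) (E m) := fun m ↦ isGalois_unrStage _ _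
  have hE : ∀ m, E m ≤ maxUnramified (v.adicCompletion K) := fun m ↦ unrStage_le_maxUnramified _ _
  have hEE : ∀ m, E m ≤ E (m + 1) := fun m ↦ unrStage_mono _ (hFmono m)
  have hdegE : ∀ (m : ℕ) (w : WeilGroup (v.adicCompletion K)), WeilGroup.toAbsGalois (v.adicCompletion K) w ∈ (E m).fixingSubgroup →
      (f m : ℤ) ∣ WeilGroup.deg w := fun m w hw' ↦
    dvd_deg_of_toAbsGalois_mem_fixingSubgroup_unramifiedLevel _ (hf0 m) w
      (IntermediateField.fixingSubgroup_antitone (unramifiedLevel_le_unrStage _ (hf0 m) (hfF m)) hw')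
  have hjj : ∀ (m : ℕ) (y : unitBall (E m)),
      unitBallToUnrCoeff (hE (m + 1)) (inclUnitBall (F := v.adicCompletion K) (hEE m) y) = unitBallToUnrCoeff (hE m) y :=
    fun m y ↦ unitBallToUnrCoeff_inclUnitBall (hE m) (hE (m + 1)) (hEE m) y
  -- (5) the cell maps of `κ_v⁻¹`, per modulus
  have hΨ : ∀ m : ℕ, ∃ ψ : (n : ℕ) → ↥(absRestrictNormalHom (rayClassField K (𝔣 m))).ker ⧸
      (rayAdicTower (𝔪 := 𝔣 m) (h𝔣0 m) v).U n → ZMod (2 ^ (n + 1)),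
      ∀ (n : ℕ) (g : ↥(absRestrictNormalHom (rayClassField K (𝔣 m))).ker),
        g ∈ (rayAdicTower (𝔪 := 𝔣 m) (h𝔣0 m) v).U 0 →
        ψ n ((rayAdicTower (𝔪 := 𝔣 m) (h𝔣0 m) v).proj n g) =
          PadicInt.toZModPow (n + 1) ((((Units.map (e₂ : v.adicCompletionIntegers K →+* ℤ_[2]).toMonoidHom).comp
            (rayAdicCharacter (h𝔣0 m) (hvm m) (hwm m)))⁻¹ g : ℤ_[2]ˣ) : ℤ_[2]) := fun m ↦
    SubgroupTower.exists_cellMap_of_character (rayAdicTower (𝔪 := 𝔣 m) (h𝔣0 m) v)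
      ((Units.map (e₂ : v.adicCompletionIntegers K →+* ℤ_[2]).toMonoidHom).comp (rayAdicCharacter (h𝔣0 m) (hvm m) (hwm m)))⁻¹
      (mem_rayAdicTower_iff_inv (h𝔣0 m) (h𝔣0 m) (hvm m) (hwm m) e₂ le_rfl (hvm m))
  choose ψ hψ using hΨ
  -- (6) the twist family: ALL ideals prime to `𝔣_0 v`; lifts of their Artin symbols serving ALL moduli; their elliptic units
  have hG : ∀ c : {c : Ideal (𝓞 K) // c ≠ ⊥ ∧ IsCoprime c (𝔣 0 * v.asIdeal)}, ∃ σ : absoluteGaloisGroup K,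
      ∀ m k : ℕ, absRestrictNormalHom (rayClassField K (𝔣 m * v.asIdeal ^ (k + 1))) σ =
        artinSymbol (galFrob K (rayClassField K (𝔣 m * v.asIdeal ^ (k + 1)))) c.1 := by
    intro c
    obtain ⟨σ, hσ⟩ := exists_forall_absRestrictNormalHom_eq_artinHom (K := K)
      (Units.mk0 (c.1 : FractionalIdeal (𝓞 K)⁰ K) (coeIdeal_ne_zero_of_ne_bot c.2.1))
    refine ⟨σ, fun m k ↦ ?_⟩
    rw [hσ _ (mul_pow_succ_ne_bot (h𝔣0 m) v k)
      (unitsMk0_coeIdeal_mem_idealsPrimeTo (mul_pow_succ_ne_bot (h𝔣0 m) v k) c.2.1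
        (isCoprime_mul_pow_succ (isCoprime_chain 𝔣 𝔩 h𝔣succ hdiv c.2.2 m) k)),
      artinHom_unitsMk0_coeIdeal _ c.2.1]
  choose g hg using hG
  have hX : ∀ (c : {c : Ideal (𝓞 K) // c ≠ ⊥ ∧ IsCoprime c (𝔣 0 * v.asIdeal)}) (m : ℕ),
      ∃ x : ∀ k : ℕ, rayClassField K (𝔣 m * v.asIdeal ^ (k + 1)),
        ∀ k, IsThetaValueOne ι (𝔣 m * v.asIdeal ^ (k + 1)) c.1
          (algClosureEmb ι ((x k : rayClassField K (𝔣 m * v.asIdeal ^ (k + 1))) : AlgebraicClosure K)) :=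
    fun c m ↦ exists_forall_isThetaValueOne' h24i hK ι (h𝔣0 m) v c.2.1 (isCoprime_chain 𝔣 𝔩 h𝔣succ hdiv c.2.2 m)
  choose x hx using hX
  -- (7) the division twists per modulus: `exists_divisionTwists_twoVariable_general` at `(𝔪_m, b_m)` (no stability / unit condition)
  obtain ⟨σ, hσσ, hσv', hnorm⟩ :=
    EllipticUnitsLocal.Discharged.exists_conj_divisionData (K := K) hK2 Nat.prime_two hv2 hvbar2 hne
  have hσv : ∀ y ∈ v.asIdeal, σ y ∈ vbar.asIdeal := conj_mem_of_mem σ hσσ hσv'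
  have hT : ∀ m : ℕ, ∃ α₁ α₂ : 𝓞 K, α₁ ≠ 0 ∧ α₂ ≠ 0 ∧ α₁ - 1 ∈ 𝔣 m ∧ α₂ - 1 ∈ 𝔣 m ∧
      IsCoprime (Ideal.span {α₁}) (𝔣 m * v.asIdeal) ∧ IsCoprime (Ideal.span {α₂}) (𝔣 m * v.asIdeal) ∧
      α₁ - 1 ∈ v.asIdeal ^ ((b m + 1) + 1) ∧ α₁ - 1 ∉ v.asIdeal ^ ((b m + 1) + 2) ∧ α₂ - 1 ∈ v.asIdeal ^ ((b m + 1) + 1) ∧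
      (∀ k : ℕ, 0 < k → ((α₂ : K) : v.adicCompletion K) ^ k ≠ ((α₁ : K) : v.adicCompletion K) ^ k) ∧
      2 ≤ Ideal.absNorm (Ideal.span {α₁}) ∧ 4 ∣ Ideal.absNorm (Ideal.span {α₁}) - 1 ∧
      Ideal.absNorm (Ideal.span {α₂}) = Ideal.absNorm (Ideal.span {α₁}) := fun m ↦ by
    rw [h𝔣eq m]
    exact exists_divisionTwists_twoVariable_general (h𝔪v m) (h𝔪vbar m) (units_eq_one_mul_sq hw2) e₂ σ hσσ hne hσv' hσv hnorm (b m)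
  choose α₁ α₂ hα₁0 hα₂0 hα₁𝔣 hα₂𝔣 hα₁c hα₂c hs₁ hs₁' hs₂ hne12 hN1 h4 hN12 using hT
  -- the twists `(αᵢ(m))` as members of the family (prime to `𝔣_0 v`: same support as `𝔣_m v`)
  have hback : ∀ (m : ℕ) {𝔞 : Ideal (𝓞 K)}, IsCoprime 𝔞 (𝔣 m * v.asIdeal) → IsCoprime 𝔞 (𝔣 0 * v.asIdeal) := by
    intro m 𝔞 h
    induction m with
    | zero => exact h
    | succ m ih => exact ih (h.of_isCoprime_of_dvd_right (mul_dvd_mul (Ideal.dvd_iff_le.mpr (hle m)) dvd_rfl))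
  haveI hN : ∀ m n, ((rayAdicTower (𝔪 := 𝔣 m) (h𝔣0 m) v).U n).Normal := fun m n ↦ rayAdicTower_U_normal (h𝔣0 m) v n
  haveI hNabs : ∀ m n, ((absRayAdicTower (𝔪' := 𝔣 m) (h𝔣0 m) v).U n).Normal := fun m n ↦ absRayAdicTower_U_normal (h𝔣0 m) v n
  -- (8) assemble
  refine ⟨h𝔣0, h𝔣1, hvm, hwm, hle, fun m ↦ α₀ ^ f m, fun m ↦ pow_ne_zero _ (ne_zero_of_asIdeal_eq_span hv0),
    hf𝔪, fun m w hw' ↦ pow_not_mem_of_ne hv0 w hw' (f m), f, hαπ, E, hfd, hgal, hE, hdegE, hEE,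
    fun m ↦ unitBallToUnrCoeff (hE m), fun m ↦ unitBallToUnrCoeff_comp_algebraMap (hE m),
    fun m ↦ algebraMap_comp_unitBallToUnrCoeff (hE m), hjj, ψ, hψ, g, hg, x, hx, hN, hNabs, ?_⟩
  exact exists_twoVariable_groupDistribution_ellipticUnitsGlobal_of_principal_steps h24ii h24iii h25 hK ι 𝔣 hle h𝔣0 h𝔣1 hvm hwm hq
    h2 u hσ₀ hε θ hθ1 e₂ hΘe (fun m ↦ α₀ ^ f m) (fun m ↦ pow_ne_zero _ (ne_zero_of_asIdeal_eq_span hv0)) hf𝔪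
    (fun m w hw' ↦ pow_not_mem_of_ne hv0 w hw' (f m)) f hαπ E hE hdegE hEE (fun m ↦ unitBallToUnrCoeff (hE m))
    (fun m ↦ unitBallToUnrCoeff_comp_algebraMap (hE m)) (fun m ↦ algebraMap_comp_unitBallToUnrCoeff (hE m)) hjj ψ hψ
    (fun c : {c : Ideal (𝓞 K) // c ≠ ⊥ ∧ IsCoprime c (𝔣 0 * v.asIdeal)} ↦ c.1) (fun c ↦ c.2.1)
    (fun c m ↦ isCoprime_chain 𝔣 𝔩 h𝔣succ hdiv c.2.2 m) g hg x hx (fun k ↦ ⟨𝔩 k, h𝔣succ k, hdiv k⟩) (fun m ↦ b m + 1)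
    (fun m ↦ Nat.succ_pos (b m))
    (fun m ↦ ⟨Ideal.span {α₁ m}, mt Ideal.span_singleton_eq_bot.mp (hα₁0 m), hback m (hα₁c m)⟩)
    (fun m ↦ ⟨Ideal.span {α₂ m}, mt Ideal.span_singleton_eq_bot.mp (hα₂0 m), hback m (hα₂c m)⟩)
    α₁ α₂ (fun _ ↦ rfl) (fun _ ↦ rfl) hα₁𝔣 hα₂𝔣 hs₁ hs₁' hs₂ hne12 hN1 h4 hN12
    ⟨Ideal.span {α₁ 0}, mt Ideal.span_singleton_eq_bot.mp (hα₁0 0), hback 0 (hα₁c 0)⟩ (hN1 0)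

end Discharged

end Summit.BirchSwinnertonDyer.BirchSwinnertonDyer.Theorems.PrintCf2.EllipticUnitsTwoVariable

end
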